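import Literature.Computability.Cryptography.LWEBinaryNoiseInstantiation
import Literature.Computability.Cryptography.LWESwitchSamplingForm
import Literature.Computability.Cryptography.IndepLawBridge
import HarnessLib

/-!
# The lattice noise `χ_N` of BLPRS's Lemma 4.9 on `Q⁻¹ℤⁿ` is a vector of iid one-dimensional discrete Gaussians

Topic `Computability/Cryptography` (LWE), grouping namespace `BLPRS2013`. The noise columns of hybrid `ℬ₂` (`LWEBinaryHybrids.hybridT₂`) are drawn from
`latticeNoiseLaw (invScaledBasisZ n Q) r` (`LWEBinaryNoiseCloseness.lean`: the integer coordinates of `x ← D_{Q⁻¹ℤⁿ, r}`). For the h₃ MACHINE this law must be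
SAMPLED; the tree's `discreteGaussian_fineGrid_eq_map` (`Algebra/EuclideanLattices/FineGridGaussian.lean`: the discrete Gaussian on the grid `Q⁻¹ℤⁿ` is the product of
scaled one-dimensional discrete Gaussians) makes it the law of `n` INDEPENDENT samples of `D_{ℤ, Qr}` — which the machine's rejection sampler draws coordinate by
coordinate. Everything PROVED; no definition, no named fact:

* **`latticeNoiseLaw_invScaledBasisZ_eq_iidPMF`** — `latticeNoiseLaw (invScaledBasisZ n Q) r = iidPMF (discreteGaussianInt (Q·r) 0) n` for `0 < r`.

## References

* Z. Brakerski, A. Langlois, C. Peikert, O. Regev, D. Stehlé, *Classical hardness of learning with errors*, STOC 2013; arXiv:1306.0281, Lemma 4.9 (proof: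
  "`N ← D^{n×m}_{q⁻¹ℤ,β}`") and §5. [BrakerskiEtAl2013]
* C. Gentry, C. Peikert, V. Vaikuntanathan, *Trapdoors for hard lattices and new cryptographic constructions*, STOC 2008, §4.1 (sampling `D_{ℤ,s,c}`; product lattices).
  [GentryPeikertVaikuntanathan2008]
-/

noncomputable section

open Literature.Algebra.EuclideanLattices Literature.Probability.Distributions

namespace Literature.Computability.Cryptography

namespace BLPRS2013

open LWE

variable (n Q : ℕ) [NeZero Q]

/-- **`χ_N` on `Q⁻¹ℤⁿ` is iid `D_{ℤ, Qr}` coordinatewise** (`0 < r`). [cite: BrakerskiEtAl2013, Lemma 4.9 (proof); GentryPeikertVaikuntanathan2008, §4.1] -/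
theorem latticeNoiseLaw_invScaledBasisZ_eq_iidPMF {r : ℝ} (hr : 0 < r) :
    latticeNoiseLaw (invScaledBasisZ n Q) r = iidPMF (discreteGaussianInt ((Q : ℝ) * r) 0) n := by
  unfold latticeNoiseLaw
  have hgrid : discreteGaussian (invScaledIntLattice n Q) r 0 =
      (indepLaw n fun _ : Fin n => discreteGaussianInt ((Q : ℝ) * r) 0).map (fineGridEquiv n Q) := by
    have h := discreteGaussian_fineGrid_eq_map (n := n) (N := Q) hr 0
    simp only [PiLp.zero_apply, mul_zero] at h
    exact h
  rw [hgrid, PMF.map_comp, indepLaw_const]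
  conv_rhs => rw [← PMF.map_id (iidPMF (discreteGaussianInt ((Q : ℝ) * r) 0) n)]
  congr 1
  funext k
  funext j
  simp only [Function.comp_apply, id_eq]
  rw [invScaledBasisZ_repr_eq_num]
  exact num_fineGridEquiv (n := n) (q' := Q) k j

end BLPRS2013

end Literature.Computability.Cryptography

end
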